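import Mathlib
import Literature.Analysis.FluidPDE.CheskidovFriedlander2009.FixedPointExistence
import HarnessLib

/-!
# Cheskidov–Friedlander 2009: the steady-state form of the zeroth law, unconditionally

Cheskidov–Friedlander, Physica D 238 (2009) 783–787 = arXiv:0810.3718v1.  The proof of Thm. 4.2
(pp. 9–10) pins the long-time mean dissipation of every viscous solution to the dissipation of the
steady state, `ν‖α^ν‖²_{H¹} = (α^ν, f) = f₀α^ν₀`, and then lets `ν → 0`: "Since `(α^ν,f) → (α⁰,f)`
as `ν → 0`, we obtain `… = (α⁰,f) = α⁰₀f₀ =: ε_d > 0`".  The first step is Thm. 3.4 (the global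
attractor, `CheskidovFriedlander2009_globalAttractor`, proved in `GlobalAttractor.lean`);
everything else is proved in this folder.  This file assembles the part that does NOT need Thm. 3.4 — the zeroth law for the
STEADY STATES themselves — as an unconditional theorem, in the shape of the anomalous-dissipation
problem (fixed force, energy bounded uniformly in the viscosity, dissipation floor independent of
the viscosity, exact limit of the dissipation as `ν → 0⁺`):

* `IsSteadyState.A_zero_lt_four_thirds`: every rescaled steady state has `A₀ < 4/3`, for EVERY
  `μ > 0` (from `A₀⁴ < 1 + μrA₀` and `μA₀ < 1`; op. cit. Lemma 2.3);
* `IsFixedPoint.apply_lt_inviscidFixedPoint`, `IsFixedPoint.normSq_le`: a non-negative `ℓ²` fixed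
  point of viscosity `ν > 0` is dominated termwise by `4/3·α⁰` (`α⁰` the inviscid fixed point,
  Thm. 2.2: `A_j ≤ A₀`), hence `|α^ν|² ≤ (4/3)²|α⁰|²` uniformly in `ν`, with
  `normSq_inviscidFixedPoint : |α⁰|² = 2^{c/3}f₀/(1 − 2^{−2c/3})`;
* `IsFixedPoint.meanDissipation_eq`: the fixed point, as a stationary solution, has mean
  dissipation `T⁻¹∫₀ᵀ ν‖α‖²_{H¹} = f₀α₀` for every `T > 0` (energy equality of `FixedPoint.lean`);
* `IsFixedPoint.half_epsilonD_lt`, `IsFixedPoint.lt_epsilonD`: the floor and ceiling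
  `ε_d/2 < ν‖α^ν‖²_{H¹} < 4ε_d/3`, the floor for `ν ≤ 2^{−c/6}√f₀` (op. cit. Thm. 4.2 via
  `SteadyState.half_lt`), the ceiling for all `ν > 0`;
* `steadyState_zerothLaw`: for `3/2 < c < 3`, `f₀ > 0` there is a family `ν ↦ α^ν` (`ν > 0`) of
  positive steady states of the viscous model with the SAME force `f₀e₀`, energy bounded uniformly
  in `ν`, dissipation `ν‖α^ν‖²_{H¹} = f₀α^ν₀ > ε_d/2` for all small `ν`, and
  `ν‖α^ν‖²_{H¹} → ε_d = 2^{c/6}f₀^{3/2} > 0` as `ν → 0⁺`.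

The time-dependent statement (Thm. 4.2 for all solutions with non-negative data) is
`CheskidovFriedlander2009_thm42_holds` in `GlobalAttractor.lean`.

## References
* [CheskidovFriedlander2009] A. Cheskidov, S. Friedlander, The vanishing viscosity limit for a
  dyadic model, Physica D 238 (2009) 783–787, §2 (Thm 2.2, Lemma 2.3) and Thm 4.2 pp. 9–10.
-/

noncomputable section

open Set Filter MeasureTheory
open scoped BigOperators Topology ENNReal

namespace Literature.Analysis.FluidPDE.CheskidovFriedlander2009

variable {c ν f₀ : ℝ} {α : ℕ → ℝ}

/-! ### A uniform bound on the rescaled steady states -/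

namespace IsSteadyState

variable {μ r : ℝ} {A : ℕ → ℝ}

/-- `μA₀ < 1` for every steady state (`A₀A₁ + μA₀ = 1` with `A₀A₁ > 0`).
[cite: CheskidovFriedlander2009, §2 (2.1)–(2.3) p.4] -/
theorem mu_mul_A_zero_lt_one (h : IsSteadyState μ r A) : μ * A 0 < 1 := by
  have := h.eq_zero
  nlinarith [mul_pos (h.pos 0) (h.pos 1)]

/-- `A₀⁴ < 3` for every steady state with `μ > 0`, `1 < r < 2`: combine `A₀⁴ < 1 + μrA₀`
(Lemma 2.3) with `μA₀ < 1` and `r < 2`. [cite: CheskidovFriedlander2009, Lemma 2.3 p.5] -/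
theorem A_zero_pow_four_lt_three (h : IsSteadyState μ r A) (hμ : 0 < μ) (hr1 : 1 < r)
    (hr2 : r < 2) : A 0 ^ 4 < 3 := by
  have h4 := h.pow_four_lt hμ hr1 hr2
  have h1 := h.mu_mul_A_zero_lt_one
  have : μ * r * A 0 < 2 := by
    have hr0 : 0 < r := by linarith
    calc μ * r * A 0 = r * (μ * A 0) := by ring
      _ < r * 1 := by gcongr
      _ < 2 := by linarith
  linarith

/-- **Uniform amplitude bound** `A₀ < 4/3`, for every `μ > 0`, `1 < r < 2` (since `(4/3)⁴ > 3`).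
[cite: CheskidovFriedlander2009, Lemma 2.3 p.5] -/
theorem A_zero_lt_four_thirds (h : IsSteadyState μ r A) (hμ : 0 < μ) (hr1 : 1 < r)
    (hr2 : r < 2) : A 0 < 4 / 3 := by
  have h3 := h.A_zero_pow_four_lt_three hμ hr1 hr2
  by_contra hle
  push Not at hle
  have : (4 / 3 : ℝ) ^ 4 ≤ A 0 ^ 4 := pow_le_pow_left₀ (by norm_num) hle 4
  norm_num at this
  linarith

/-- Hence `A_j < 4/3` for all `j` (Thm. 2.2: `A_j ≤ A₀`).
[cite: CheskidovFriedlander2009, Thm 2.2 p.4] -/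
theorem lt_four_thirds (h : IsSteadyState μ r A) (hμ : 0 < μ) (hr1 : 1 < r) (hr2 : r < 2)
    (j : ℕ) : A j < 4 / 3 :=
  (h.le_A_zero hμ hr1 hr2 j).trans_lt (h.A_zero_lt_four_thirds hμ hr1 hr2)

end IsSteadyState

/-! ### The parameters of the rescaling -/

/-- `μ = ν2^{c/6}f₀^{−1/2} > 0` for `ν, f₀ > 0`. [cite: CheskidovFriedlander2009, §2 p.4] -/
theorem mu_pos (hν : 0 < ν) (hf : 0 < f₀) : 0 < ν * (2 : ℝ) ^ (c / 6) / Real.sqrt f₀ := by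
  have : 0 < (2 : ℝ) ^ (c / 6) := Real.rpow_pos_of_pos two_pos _
  have : 0 < Real.sqrt f₀ := Real.sqrt_pos.mpr hf
  positivity

/-- `1 < r = 2^{2 − 2c/3}` iff `c < 3`. [cite: CheskidovFriedlander2009, §2 p.4] -/
theorem one_lt_r (hc3 : c < 3) : 1 < (2 : ℝ) ^ (2 - 2 * c / 3) :=
  Real.one_lt_rpow (by norm_num) (by linarith)

/-- `r = 2^{2 − 2c/3} < 2` iff `3/2 < c`. [cite: CheskidovFriedlander2009, §2 p.4] -/
theorem r_lt_two (hc : 3 / 2 < c) : (2 : ℝ) ^ (2 - 2 * c / 3) < 2 :=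
  calc (2 : ℝ) ^ (2 - 2 * c / 3) < (2 : ℝ) ^ (1 : ℝ) :=
        Real.rpow_lt_rpow_of_exponent_lt (by norm_num) (by linarith)
    _ = 2 := Real.rpow_one 2

/-! ### The inviscid fixed point: its energy -/

/-- `|α⁰|² = (2^{c/6})²f₀/(1 − (2^{−c/3})²)` (a geometric series), for `c > 0`, `f₀ ≥ 0`.
[cite: CheskidovFriedlander2009, §2 p.4] -/
theorem normSq_inviscidFixedPoint (hc : 0 < c) (hf : 0 ≤ f₀) :
    normSq (inviscidFixedPoint c f₀) =
      ((2 : ℝ) ^ (c / 6)) ^ 2 * f₀ / (1 - ((2 : ℝ) ^ (-(c / 3))) ^ 2) := by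
  set q : ℝ := (2 : ℝ) ^ (-(c / 3)) with hq
  have hq0 : 0 ≤ q := (Real.rpow_pos_of_pos two_pos _).le
  have hq1 : q < 1 := by
    rw [hq]
    exact Real.rpow_lt_one_of_one_lt_of_neg (by norm_num) (by linarith)
  have hq2 : q ^ 2 < 1 := by nlinarith
  unfold normSq
  simp_rw [inviscidFixedPoint_sq c hf]
  rw [tsum_mul_left, tsum_geometric_of_lt_one (by positivity) hq2]
  ring

/-- `|α⁰|²` is finite and positive data: `Summable (α⁰_j)²`.
[cite: CheskidovFriedlander2009, §2 p.4] -/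
theorem summable_inviscidFixedPoint_sq (hc : 0 < c) (hf : 0 ≤ f₀) :
    Summable fun j => inviscidFixedPoint c f₀ j ^ 2 :=
  (isFixedPoint_inviscidFixedPoint hc hf).1

/-! ### Viscous fixed points are dominated by `4/3 · α⁰`, uniformly in `ν` -/

/-- **Termwise domination**: a non-negative `ℓ²` fixed point of viscosity `ν > 0` satisfies
`α_j < (4/3)α⁰_j` for all `j`, whatever `ν` (`3/2 < c < 3`).
[cite: CheskidovFriedlander2009, Thm 2.2 p.4 and Lemma 2.3 p.5] -/
theorem IsFixedPoint.apply_lt_inviscidFixedPoint (hα : IsFixedPoint c ν (force f₀) α)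
    (hc : 3 / 2 < c) (hc3 : c < 3) (hν : 0 < ν) (hf : 0 < f₀) (hnn : ∀ j, 0 ≤ α j) (j : ℕ) :
    α j < 4 / 3 * inviscidFixedPoint c f₀ j := by
  have hst := hα.isSteadyState hc3.le hν hf hnn
  have hA := hst.lt_four_thirds (mu_pos hν hf) (one_lt_r hc3) (r_lt_two hc) j
  have hκ := inviscidFixedPoint_pos c hf j
  rwa [div_lt_iff₀ hκ] at hA

/-- **Uniform energy bound**: `|α^ν|² ≤ (4/3)²|α⁰|²` for every non-negative `ℓ²` fixed point of
viscosity `ν > 0` (`3/2 < c < 3`). [cite: CheskidovFriedlander2009, Thm 2.2 p.4 and Lemma 2.3 p.5] -/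
theorem IsFixedPoint.normSq_le (hα : IsFixedPoint c ν (force f₀) α) (hc : 3 / 2 < c)
    (hc3 : c < 3) (hν : 0 < ν) (hf : 0 < f₀) (hnn : ∀ j, 0 ≤ α j) :
    normSq α ≤ (4 / 3) ^ 2 * normSq (inviscidFixedPoint c f₀) := by
  have hc0 : 0 < c := by linarith
  unfold normSq
  rw [← tsum_mul_left]
  refine hα.1.tsum_le_tsum (fun j => ?_) ((summable_inviscidFixedPoint_sq hc0 hf.le).mul_left _)
  have h := hα.apply_lt_inviscidFixedPoint hc hc3 hν hf hnn j
  have h0 := hnn j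
  rw [← mul_pow]
  exact pow_le_pow_left₀ h0 h.le 2

/-- The uniform energy bound in closed form: `|α^ν|² ≤ (16/9)·(2^{c/6})²f₀/(1 − (2^{−c/3})²)`.
[cite: CheskidovFriedlander2009, Thm 2.2 p.4 and Lemma 2.3 p.5] -/
theorem IsFixedPoint.normSq_le' (hα : IsFixedPoint c ν (force f₀) α) (hc : 3 / 2 < c)
    (hc3 : c < 3) (hν : 0 < ν) (hf : 0 < f₀) (hnn : ∀ j, 0 ≤ α j) :
    normSq α ≤ (4 / 3) ^ 2 * (((2 : ℝ) ^ (c / 6)) ^ 2 * f₀ / (1 - ((2 : ℝ) ^ (-(c / 3))) ^ 2)) := by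
  rw [← normSq_inviscidFixedPoint (by linarith) hf.le]
  exact hα.normSq_le hc hc3 hν hf hnn

/-! ### The dissipation of a steady state -/

/-- The `H¹` seminorm of an `H¹`-summable sequence, as a real number:
`(h1NormSq α).toReal = Σ_j 2^{2j}α_j²`. [cite: CheskidovFriedlander2009, §1 p.3 (norms)] -/
theorem h1NormSq_toReal_eq {α : ℕ → ℝ} (hs : Summable fun j => (2 : ℝ) ^ (2 * j) * α j ^ 2) :
    (h1NormSq α).toReal = ∑' j, (2 : ℝ) ^ (2 * j) * α j ^ 2 := by
  have hnn : ∀ j, 0 ≤ (2 : ℝ) ^ (2 * j) * α j ^ 2 := fun j =>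
    mul_nonneg (pow_nonneg zero_le_two _) (sq_nonneg _)
  unfold h1NormSq
  rw [← ENNReal.ofReal_tsum_of_nonneg hnn hs, ENNReal.toReal_ofReal (tsum_nonneg hnn)]

/-- **Mean dissipation of a steady state**: viewed as the stationary solution `t ↦ α`, a
non-negative `ℓ²` fixed point (`c ≤ 3`, `ν > 0`) has `T⁻¹∫₀ᵀ ν‖α‖²_{H¹} dt = ν‖α‖²_{H¹} = f₀α₀`
for every `T > 0`. [cite: CheskidovFriedlander2009, Thm 4.2 p.9–10 (proof: `ν‖α^ν‖²_{H¹} = (α^ν,f)`)] -/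
theorem IsFixedPoint.meanDissipation_eq (hα : IsFixedPoint c ν (force f₀) α) (hc3 : c ≤ 3)
    (hν : 0 < ν) (hnn : ∀ j, 0 ≤ α j) {T : ℝ} (hT : 0 < T) :
    meanDissipation ν (fun j _ => α j) T = f₀ * α 0 := by
  have hs := hα.summable_h1 hν hnn
  unfold meanDissipation
  rw [setLIntegral_const, Real.volume_Ioc, sub_zero, ENNReal.toReal_mul,
    ENNReal.toReal_ofReal hT.le, h1NormSq_toReal_eq hs, ← hα.energy_eq hc3 hν hnn]
  field_simp

/-- **Dissipation floor, uniform in the viscosity**: for `ν ≤ 2^{−c/6}√f₀` (i.e. `μ ≤ 1`) every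
non-negative `ℓ²` fixed point has `ε_d/2 < f₀α₀ = ν‖α‖²_{H¹}` (`3/2 < c < 3`), from `A₀ > 1/2`
(`SteadyState.half_lt`). [cite: CheskidovFriedlander2009, Thm 4.2 p.9–10 and Lemma 2.3 p.5] -/
theorem IsFixedPoint.half_epsilonD_lt (hα : IsFixedPoint c ν (force f₀) α) (hc : 3 / 2 < c)
    (hc3 : c < 3) (hν : 0 < ν) (hf : 0 < f₀) (hnn : ∀ j, 0 ≤ α j)
    (hμ1 : ν * (2 : ℝ) ^ (c / 6) / Real.sqrt f₀ ≤ 1) : epsilonD c f₀ / 2 < f₀ * α 0 := by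
  have hst := hα.isSteadyState hc3.le hν hf hnn
  have hA := hst.half_lt (mu_pos hν hf) hμ1 (one_lt_r hc3) (r_lt_two hc)
  have hκ := inviscidFixedPoint_pos c hf 0
  rw [lt_div_iff₀ hκ] at hA
  unfold epsilonD
  nlinarith

/-- The floor for the `H¹` dissipation itself: `ε_d/2 < ν Σ_j 2^{2j}α_j²` (energy equality).
[cite: CheskidovFriedlander2009, Thm 4.2 p.9–10] -/
theorem IsFixedPoint.half_epsilonD_lt_dissipation (hα : IsFixedPoint c ν (force f₀) α)
    (hc : 3 / 2 < c) (hc3 : c < 3) (hν : 0 < ν) (hf : 0 < f₀) (hnn : ∀ j, 0 ≤ α j)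
    (hμ1 : ν * (2 : ℝ) ^ (c / 6) / Real.sqrt f₀ ≤ 1) :
    epsilonD c f₀ / 2 < ν * ∑' j, (2 : ℝ) ^ (2 * j) * α j ^ 2 := by
  rw [hα.energy_eq hc3.le hν hnn]
  exact hα.half_epsilonD_lt hc hc3 hν hf hnn hμ1

/-- **Dissipation ceiling, for every viscosity**: `f₀α₀ < (4/3)ε_d` (`A₀ < 4/3`).
[cite: CheskidovFriedlander2009, Lemma 2.3 p.5] -/
theorem IsFixedPoint.lt_epsilonD (hα : IsFixedPoint c ν (force f₀) α) (hc : 3 / 2 < c)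
    (hc3 : c < 3) (hν : 0 < ν) (hf : 0 < f₀) (hnn : ∀ j, 0 ≤ α j) :
    f₀ * α 0 < 4 / 3 * epsilonD c f₀ := by
  have h := hα.apply_lt_inviscidFixedPoint hc hc3 hν hf hnn 0
  unfold epsilonD
  nlinarith

/-! ### The steady-state zeroth law -/

/-- **The steady-state zeroth law of the viscous dyadic model, unconditionally** (`3/2 < c < 3`,
`f₀ > 0`; in particular the paper's range `c ∈ (3/2, 5/2]`): there is a family `ν ↦ α^ν`, `ν > 0`,
of positive `ℓ²` steady states of the viscous model — stationary solutions, all driven by the same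
force `f₀e₀` — such that
* (energy bound, uniform in `ν`) `|α^ν|² ≤ (4/3)²|α⁰|²` for all `ν > 0`;
* (energy equality) `ν‖α^ν‖²_{H¹} = f₀α^ν₀`, which is also the mean dissipation
  `T⁻¹∫₀ᵀ ν‖α^ν‖²_{H¹}` over every window `[0,T]`;
* (floor, uniform in `ν`) `ν‖α^ν‖²_{H¹} > ε_d/2` whenever `ν ≤ 2^{−c/6}√f₀`;
* (exact limit) `ν‖α^ν‖²_{H¹} → ε_d = 2^{c/6}f₀^{3/2} > 0` as `ν → 0⁺`.
This is the content of the proof of Thm. 4.2 minus the global attractor (Thm. 3.4); with Thm. 3.4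
the same number is the long-time mean dissipation of every solution with non-negative datum
(`CheskidovFriedlander2009_thm42_holds`, `GlobalAttractor.lean`).
[cite: CheskidovFriedlander2009, Thm 4.2 pp.9–10 (proof), Thm 2.2 p.4, Lemma 2.3 p.5] -/
theorem steadyState_zerothLaw (hc : 3 / 2 < c) (hc3 : c < 3) (hf : 0 < f₀) :
    ∃ α : ℝ → ℕ → ℝ,
      (∀ ν, 0 < ν → IsFixedPoint c ν (force f₀) (α ν) ∧ (∀ j, 0 < α ν j) ∧
        IsSolution c ν (force f₀) (fun j _ => α ν j)) ∧
      (∀ ν, 0 < ν → normSq (α ν) ≤ (4 / 3) ^ 2 * normSq (inviscidFixedPoint c f₀)) ∧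
      (∀ ν, 0 < ν → ν * ∑' j, (2 : ℝ) ^ (2 * j) * α ν j ^ 2 = f₀ * α ν 0) ∧
      (∀ ν, 0 < ν → ∀ T, 0 < T → meanDissipation ν (fun j _ => α ν j) T = f₀ * α ν 0) ∧
      (∀ ν, 0 < ν → ν * (2 : ℝ) ^ (c / 6) / Real.sqrt f₀ ≤ 1 →
        epsilonD c f₀ / 2 < ν * ∑' j, (2 : ℝ) ^ (2 * j) * α ν j ^ 2) ∧
      Tendsto (fun ν => ν * ∑' j, (2 : ℝ) ^ (2 * j) * α ν j ^ 2) (𝓝[>] 0)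
        (𝓝 (epsilonD c f₀)) ∧
      0 < epsilonD c f₀ := by
  have hex : ∀ ν : ℝ, 0 < ν → ∃ α : ℕ → ℝ, IsFixedPoint c ν (force f₀) α ∧ ∀ j, 0 ≤ α j :=
    fun ν hν =>
      let ⟨α, hα, hnn, _⟩ := exists_isFixedPoint c hν hf
      ⟨α, hα, hnn⟩
  choose! α hα hnn using hex
  have henergy : ∀ ν, 0 < ν → ν * ∑' j, (2 : ℝ) ^ (2 * j) * α ν j ^ 2 = f₀ * α ν 0 :=
    fun ν hν => (hα ν hν).energy_eq hc3.le hν (hnn ν hν)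
  refine ⟨α, fun ν hν => ⟨hα ν hν, (hα ν hν).pos hf (hnn ν hν), (hα ν hν).isSolution⟩,
    fun ν hν => (hα ν hν).normSq_le hc hc3 hν hf (hnn ν hν), henergy,
    fun ν hν T hT => (hα ν hν).meanDissipation_eq hc3.le hν (hnn ν hν) hT,
    fun ν hν hμ1 => (hα ν hν).half_epsilonD_lt_dissipation hc hc3 hν hf (hnn ν hν) hμ1, ?_,
    epsilonD_pos c hf⟩
  -- the limit: `ν‖α^ν‖²_{H¹} = f₀α^ν₀ → ε_d` on `(0, ∞)`
  have hlim := tendsto_epsilon_of_fixedPoints hc hc3 hf fun ν hν => ⟨hα ν hν, hnn ν hν⟩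
  refine hlim.congr' ?_
  filter_upwards [self_mem_nhdsWithin] with ν hν
  exact (henergy ν hν).symm

/-- **Corollary (the anomalous-dissipation shape)**: for `3/2 < c < 3`, `f₀ > 0` there are
`E, ε, ν₀ > 0` and steady states `α^ν` (`ν > 0`) of the viscous dyadic model with force `f₀e₀`
such that `|α^ν|² ≤ E` for all `ν > 0` and `ν‖α^ν‖²_{H¹} ≥ ε` for all `ν ∈ (0, ν₀]` — bounded
energy, dissipation bounded away from zero uniformly as `ν → 0`.
[cite: CheskidovFriedlander2009, Thm 4.2 pp.9–10] -/
theorem exists_steadyStates_dissipation_floor (hc : 3 / 2 < c) (hc3 : c < 3) (hf : 0 < f₀) :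
    ∃ E ε ν₀ : ℝ, 0 < E ∧ 0 < ε ∧ 0 < ν₀ ∧ ∃ α : ℝ → ℕ → ℝ,
      (∀ ν, 0 < ν → IsFixedPoint c ν (force f₀) (α ν) ∧ (∀ j, 0 < α ν j)) ∧
      (∀ ν, 0 < ν → normSq (α ν) ≤ E) ∧
      (∀ ν, 0 < ν → ν ≤ ν₀ → ε ≤ ν * ∑' j, (2 : ℝ) ^ (2 * j) * α ν j ^ 2) := by
  obtain ⟨α, hsol, hE, -, -, hfloor, -, hεd⟩ := steadyState_zerothLaw hc hc3 hf
  have h26 : 0 < (2 : ℝ) ^ (c / 6) := Real.rpow_pos_of_pos two_pos _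
  have hs : 0 < Real.sqrt f₀ := Real.sqrt_pos.mpr hf
  have hE0 : 0 < (4 / 3 : ℝ) ^ 2 * normSq (inviscidFixedPoint c f₀) := by
    have : 0 < normSq (inviscidFixedPoint c f₀) := by
      unfold normSq
      exact (summable_inviscidFixedPoint_sq (by linarith) hf.le).tsum_pos
        (fun j => sq_nonneg _) 0 (pow_pos (inviscidFixedPoint_pos c hf 0) 2)
    positivity
  refine ⟨(4 / 3) ^ 2 * normSq (inviscidFixedPoint c f₀), epsilonD c f₀ / 2,
    Real.sqrt f₀ / (2 : ℝ) ^ (c / 6), hE0, by linarith, by positivity, α,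
    fun ν hν => ⟨(hsol ν hν).1, (hsol ν hν).2.1⟩, hE, fun ν hν hν₀ => ?_⟩
  have hμ1 : ν * (2 : ℝ) ^ (c / 6) / Real.sqrt f₀ ≤ 1 := by
    rw [div_le_iff₀ hs, one_mul]
    rwa [le_div_iff₀ h26] at hν₀
  exact (hfloor ν hν hμ1).le

end Literature.Analysis.FluidPDE.CheskidovFriedlander2009

end
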